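import Mathlib.NumberTheory.Padics.RingHoms
import Mathlib.Tactic.NormNum.Prime
import Mathlib.Topology.Algebra.Valued.NormedValued
import Mathlib.GroupTheory.Perm.Cycle.Type
import Mathlib.GroupTheory.Coset.Card
import Summits.ABC.ABC.Theorems.KenkuLevelTwentySixCertificate
import Literature.NumberTheory.EllipticCurves.MordellWeilRankZeroProofs
import Literature.NumberTheory.EllipticCurves.PointReduction
import Literature.NumberTheory.EllipticCurves.KubertTwoTwelveProofs
import HarnessLib

/-!
# `KenkuPrintedLevels` (stmt-ABC-18224) (ii), level `26`: the Mordell–Weil input `hMW` of `26a1`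
# REDUCED to the rank statement `rank_ℤ 26a1(ℚ) = 0`

`Summits/ABC/ABC/Theorems/KenkuLevelTwentySixMWReduction.lean` — unit `abc-inputs-pr-1` (KEY KENKU26,
INPUTS-LIST row I-07/26; PROOFS ONLY: 0 definitions, 0 named facts; `--supports stmt-ABC-18224 --as
helper`). Level-`26` twin of `KenkuLevelThirtyFiveMWReduction.lean` (unit `abc-inputs-pr-4`), whose proof
it follows line by line.

`KenkuLevelTwentySixCertificate.lean` reduces Kenku's printed level `26` ("no cyclic rational
`26`-isogeny") to Klein–Fricke at `13` (cite-only fact) and ONE explicit input, the Mordell–Weil group of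
Cremona's `26a1` in the tree's model
`E = WeierstrassCurve.threeTorsionModel 7 52 = [0, 49, 0, 728, 2704] : Y² = X³ + (7X + 52)²`:
`hMW : ∀ X Y : ℚ, Y² = X³ + (7X + 52)² → X = 0`. This file proves

* `x_eq_zero_of_rank_zero` / **`mordellWeil_26a1_of_rank_zero`**: `hMW` follows from the DESCENT
  STATEMENT `(threeTorsionModel (7 : ℚ) 52).mordellWeilRank = 0` ("`rank_ℤ 26a1(ℚ) = 0`");
* `isCyclic_degree_ne_twentySix_of_rank_zero`: hence level `26` ⟸ Klein–Fricke at `13` + `rank_ℤ 26a1(ℚ) = 0`.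

**Proof** (Cremona, *Algorithms*, §3.3; Silverman, *AEC*, VII.3.1, VIII.6.7). Rank `0` and the tree's
PROVED Mordell–Weil theorem make `E(ℚ)` finite (`WeierstrassCurve.finite_point_of_rank_zero`). `E` has
good reduction at `3` and `11` (`Δ = -2¹⁵·13³ = -71991296`) with `#Ẽ(𝔽₃) = 3` and `#Ẽ(𝔽₁₁) = 6`
(enumeration, `decide`), and the prime-to-`ℓ` torsion injects into `Ẽ(𝔽_ℓ)` (the tree's `reduceHom` /
`injective_reduceHom`, `PointReduction.lean`). For `P ∈ E(ℚ)` of order `11ᵇ·m`, `11 ∤ m`: `mP` is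
prime-to-`3` torsion, so `3mP = 0` and `P` is prime-to-`11` torsion; hence ALL of `E(ℚ)` injects into
`Ẽ(𝔽₁₁)`, `#E(ℚ) ∣ 6`, `6P = 0`; then `3P` is killed by `2`, is prime-to-`3` torsion, so `9P = 0` and
`3P = 9P − 6P = 0`: `E(ℚ)` has exponent `3`, so `2 ∤ #E(ℚ)` (Cauchy) and `#E(ℚ) ∣ 3`. The points
`O, (0, 52), (0, -52)` are distinct, so a fourth point `(X, Y)` with `X ≠ 0` is impossible.

HONESTY. An INPUTS→UNCONDITIONAL reduction at abc distance 0: `hMW` is NOT proved here — it is reduced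
to `rank_ℤ 26a1(ℚ) = 0`, the target of the `3`-isogeny descent (`KenkuLevelTwentySixRankZero.lean`).
Proving it moves abc by 0; NOT abc; typed ≠ proved.

References: [CremonaAlgorithms1997] Table 1, `N = 26`, curve `A1 = [1,0,1,-5,-8]` (`r = 0`, `|T| = 3`),
§3.3; [SilvermanAEC2009] Prop. VII.3.1(b), Thm. VIII.6.7; [Kenku1982] Thm. 1.
-/

-- `Summit.ABC.ABC` is the mandated summit-side namespace (CONVENTIONS §2); the duplicate is deliberate.
set_option linter.dupNamespace false

noncomputable section

open scoped NNReal
open WeierstrassCurve WeierstrassCurve.Affine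
open Literature.NumberTheory.EllipticCurves

namespace Summit.ABC.ABC.Theorems

namespace KenkuLevelTwentySixMW

/-! ### `26a1 = E_{7,52}` modulo `ℓ` and its points over `𝔽₃` and `𝔽₁₁` -/

/-- `Δ(E_{7,52}) = 16·52³·(4·7³ - 27·52) = -71991296 = -2¹⁵·13³`.
[cite: CremonaAlgorithms1997, Table 1, N = 26, curve A1] -/
theorem Δ_eq : (threeTorsionModel (7 : ℚ) 52).Δ = -71991296 := by
  rw [Δ_threeTorsionModel]; norm_num

/-- `Δ = -71991296` for the reduction `[0, 49, 0, 728, 2704]` of `E_{7,52}` modulo `ℓ`, so that it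
is an elliptic curve over `𝔽_ℓ` for `ℓ ∉ {2, 13}`. [folklore] -/
theorem reduction_Δ (ℓ : ℕ) :
    (⟨0, 49, 0, 728, 2704⟩ : WeierstrassCurve (ZMod ℓ)).Δ = -71991296 := by
  norm_num [WeierstrassCurve.Δ, b₂, b₄, b₆, b₈]

/-- The affine equation of `E_{7,52}` modulo `ℓ`: `y² = x³ + 49x² + 728x + 2704`. [folklore] -/
theorem equation_reduction_iff (ℓ : ℕ) (x y : ZMod ℓ) :
    (⟨0, 49, 0, 728, 2704⟩ : WeierstrassCurve (ZMod ℓ)).toAffine.Equation x y ↔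
      y ^ 2 = x ^ 3 + 49 * x ^ 2 + 728 * x + 2704 := by
  rw [Affine.equation_iff]
  constructor <;> intro h <;> linear_combination h

/-- `y² = x³ + 49x² + 728x + 2704` has exactly `2` affine solutions over `𝔽₃` (`(0, ±1)`).
[folklore] -/
theorem card_solutions_three :
    Fintype.card {xy : ZMod 3 × ZMod 3 //
      xy.2 ^ 2 = xy.1 ^ 3 + 49 * xy.1 ^ 2 + 728 * xy.1 + 2704} = 2 := by
  decide

/-- `y² = x³ + 49x² + 728x + 2704` has exactly `5` affine solutions over `𝔽₁₁`. [folklore] -/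
theorem card_solutions_eleven :
    Fintype.card {xy : ZMod 11 × ZMod 11 //
      xy.2 ^ 2 = xy.1 ^ 3 + 49 * xy.1 ^ 2 + 728 * xy.1 + 2704} = 5 := by
  decide

/-- **`#Ẽ(𝔽₃) = 3`** for `E = 26a1` (`a₃ = 1`). [cite: CremonaAlgorithms1997, Table 1, N = 26, curve A1] -/
theorem natCard_point_reduction_three :
    Nat.card (⟨0, 49, 0, 728, 2704⟩ : WeierstrassCurve (ZMod 3)).toAffine.Point = 3 := by
  have hΔ : (-71991296 : ZMod 3) ≠ 0 := by decide
  haveI : Fact (Nat.Prime 3) := ⟨by norm_num⟩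
  haveI : (⟨0, 49, 0, 728, 2704⟩ : WeierstrassCurve (ZMod 3)).IsElliptic :=
    ⟨by rw [reduction_Δ]; exact isUnit_iff_ne_zero.mpr hΔ⟩
  have e : {xy : ZMod 3 × ZMod 3 //
      (⟨0, 49, 0, 728, 2704⟩ : WeierstrassCurve (ZMod 3)).toAffine.Equation xy.1 xy.2} ≃
      {xy : ZMod 3 × ZMod 3 // xy.2 ^ 2 = xy.1 ^ 3 + 49 * xy.1 ^ 2 + 728 * xy.1 + 2704} :=
    Equiv.subtypeEquivRight fun xy => equation_reduction_iff 3 xy.1 xy.2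
  rw [Nat.card_congr (WeierstrassCurve.Affine.pointEquiv
    (⟨0, 49, 0, 728, 2704⟩ : WeierstrassCurve (ZMod 3)).toAffine)]
  change Nat.card (Option _) = 3
  rw [Finite.card_option, Nat.card_congr e, Nat.card_eq_fintype_card, card_solutions_three]

/-- **`#Ẽ(𝔽₁₁) = 6`** for `E = 26a1` (`a₁₁ = 6`). [cite: CremonaAlgorithms1997, Table 1, N = 26, curve A1] -/
theorem natCard_point_reduction_eleven :
    Nat.card (⟨0, 49, 0, 728, 2704⟩ : WeierstrassCurve (ZMod 11)).toAffine.Point = 6 := by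
  have hΔ : (-71991296 : ZMod 11) ≠ 0 := by decide
  haveI : Fact (Nat.Prime 11) := ⟨by norm_num⟩
  haveI : (⟨0, 49, 0, 728, 2704⟩ : WeierstrassCurve (ZMod 11)).IsElliptic :=
    ⟨by rw [reduction_Δ]; exact isUnit_iff_ne_zero.mpr hΔ⟩
  have e : {xy : ZMod 11 × ZMod 11 //
      (⟨0, 49, 0, 728, 2704⟩ : WeierstrassCurve (ZMod 11)).toAffine.Equation xy.1 xy.2} ≃
      {xy : ZMod 11 × ZMod 11 // xy.2 ^ 2 = xy.1 ^ 3 + 49 * xy.1 ^ 2 + 728 * xy.1 + 2704} :=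
    Equiv.subtypeEquivRight fun xy => equation_reduction_iff 11 xy.1 xy.2
  rw [Nat.card_congr (WeierstrassCurve.Affine.pointEquiv
    (⟨0, 49, 0, 728, 2704⟩ : WeierstrassCurve (ZMod 11)).toAffine)]
  change Nat.card (Option _) = 6
  rw [Finite.card_option, Nat.card_congr e, Nat.card_eq_fintype_card, card_solutions_eleven]

/-! ### The `ℓ`-adic absolute value of `ℚ` and the reduction homomorphism

(The two generic facts `‖z‖_ℓ ≤ 1` for `z ∈ ℤ` and `‖n‖_ℓ = 1` for `ℓ ∤ n` are the tree's
`Curve24A1.intCast_mem_integer` / `Curve24A1.valuation_natCast_eq_one`, `KubertTwoTwelveProofs.lean`.) -/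

section Local

variable (ℓ : ℕ) [Fact ℓ.Prime]

/-- `E_{7,52}` is an `ℓ`-integral equation: it is the base change of `E_{7,52}` over `ℤ_(ℓ)`.
[folklore] -/
theorem isIntegral_E :
    (threeTorsionModel (7 : ℚ) 52).IsIntegral
      (NormedField.valuation.comap (Rat.castHom ℚ_[ℓ]) : Valuation ℚ ℝ≥0).integer :=
  ⟨⟨threeTorsionModel ⟨7, Curve24A1.intCast_mem_integer ℓ 7⟩ ⟨52, Curve24A1.intCast_mem_integer ℓ 52⟩, by
    rw [WeierstrassCurve.baseChange, map_threeTorsionModel]; rfl⟩⟩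

/-- **Good reduction at `ℓ ∉ {2, 13}`**: for `ℓ` prime to `71991296 = 2¹⁵·13³`, `‖Δ‖_ℓ = 1`.
[cite: CremonaAlgorithms1997, Table 1, N = 26 (conductor 26)] -/
theorem valuation_Δ (h : IsCoprime (71991296 : ℤ) ℓ) :
    (NormedField.valuation.comap (Rat.castHom ℚ_[ℓ]) : Valuation ℚ ℝ≥0)
      (threeTorsionModel (7 : ℚ) 52).Δ = 1 := by
  rw [Δ_eq, Valuation.comap_apply, ← NNReal.coe_eq_one]
  change ‖((-71991296 : ℚ) : ℚ_[ℓ])‖ = 1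
  rw [show ((-71991296 : ℚ) : ℚ_[ℓ]) = ((-71991296 : ℤ) : ℚ_[ℓ]) by norm_cast]
  exact Padic.norm_intCast_eq_one_iff.mpr h.neg_left

/-- **The prime-to-`ℓ` torsion of `E_{7,52}(ℚ)` injects into `Ẽ(𝔽_ℓ)`** at a prime `ℓ` of good
reduction (Silverman, *AEC*, Prop. VII.3.1(b); the tree's `reduceHom` / `injective_reduceHom` of
`PointReduction.lean` for the `ℓ`-adic absolute value of `ℚ` and the residue map
`ℤ_(ℓ) → ℤ_ℓ → 𝔽_ℓ`, as in `Curve24A1.exists_reduceHom`). The group laws are Mathlib's, at the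
classical `DecidableEq` instances. [cite: SilvermanAEC2009, Prop. VII.3.1(b)] -/
theorem exists_reduceHom (h : IsCoprime (71991296 : ℤ) ℓ) :
    letI := Classical.decEq ℚ
    letI := Classical.decEq (ZMod ℓ)
    ∃ f : goodTorsion (NormedField.valuation.comap (Rat.castHom ℚ_[ℓ]) : Valuation ℚ ℝ≥0)
        (threeTorsionModel (7 : ℚ) 52) →+ (⟨0, 49, 0, 728, 2704⟩ : WeierstrassCurve (ZMod ℓ)).toAffine.Point,
      Function.Injective f := by
  letI := Classical.decEq ℚ
  letI := Classical.decEq (ZMod ℓ)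
  set w : Valuation ℚ ℝ≥0 := NormedField.valuation.comap (Rat.castHom ℚ_[ℓ]) with hw
  have hw1 : ∀ q : ℚ, w q ≤ 1 ↔ ‖(q : ℚ_[ℓ])‖ ≤ 1 := fun q => by
    rw [hw, Valuation.comap_apply, ← NNReal.coe_le_coe, NNReal.coe_one]; rfl
  have hw1' : ∀ q : ℚ, w q < 1 ↔ ‖(q : ℚ_[ℓ])‖ < 1 := fun q => by
    rw [hw, Valuation.comap_apply, ← NNReal.coe_lt_coe, NNReal.coe_one]; rfl
  haveI : (threeTorsionModel (7 : ℚ) 52).IsIntegral w.integer := isIntegral_E ℓ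
  -- the residue map `ℤ_(ℓ) → ℤ_ℓ → 𝔽_ℓ`
  let ι : w.integer →+* ℤ_[ℓ] :=
    { toFun := fun a => ⟨((a : ℚ) : ℚ_[ℓ]), (hw1 a).mp a.2⟩
      map_one' := Subtype.ext (by simp)
      map_mul' := fun a b => Subtype.ext (by simp)
      map_zero' := Subtype.ext (by simp)
      map_add' := fun a b => Subtype.ext (by simp) }
  let r : w.integer →+* ZMod ℓ := PadicInt.toZMod.comp ι
  have hr : ∀ a : w.integer, r a = 0 ↔ w (a : ℚ) < 1 := fun a => by
    rw [hw1', RingHom.comp_apply, ← RingHom.mem_ker, PadicInt.ker_toZMod,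
      IsLocalRing.mem_maximalIdeal, PadicInt.mem_nonunits, PadicInt.norm_def]
    rfl
  have hΔ : w (threeTorsionModel (7 : ℚ) 52).Δ = 1 := valuation_Δ ℓ h
  -- the reduced equation
  have hred : reduceCurve r (threeTorsionModel (7 : ℚ) 52) =
      (⟨0, 49, 0, 728, 2704⟩ : WeierstrassCurve (ZMod ℓ)) := by
    ext
    · show reduceFun r (0 : ℚ) = 0
      rw [show (0 : ℚ) = ((0 : ℤ) : ℚ) by norm_num, reduceFun_intCast]; norm_num
    · show reduceFun r ((7 : ℚ) ^ 2) = 49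
      rw [show ((7 : ℚ) ^ 2) = ((49 : ℤ) : ℚ) by norm_num, reduceFun_intCast]; norm_num
    · show reduceFun r (0 : ℚ) = 0
      rw [show (0 : ℚ) = ((0 : ℤ) : ℚ) by norm_num, reduceFun_intCast]; norm_num
    · show reduceFun r (2 * 7 * 52 : ℚ) = 728
      rw [show (2 * 7 * 52 : ℚ) = ((728 : ℤ) : ℚ) by norm_num, reduceFun_intCast]; norm_num
    · show reduceFun r ((52 : ℚ) ^ 2) = 2704
      rw [show ((52 : ℚ) ^ 2) = ((2704 : ℤ) : ℚ) by norm_num, reduceFun_intCast]; norm_num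
  exact ⟨reduceHom w r hr hΔ hred, injective_reduceHom hr hΔ hred⟩

end Local

/-! ### From rank `0` to `E(ℚ) = {O, (0, ±52)}` -/

/-- **`rank_ℤ 26a1(ℚ) = 0 ⟹` every rational point has `X = 0`** (the points of
`E_{7,52} = threeTorsionModel 7 52`, nonsingular form). Rank `0` and Mordell–Weil make `E(ℚ)` finite;
reduction modulo `3` (`#Ẽ = 3`) and `11` (`#Ẽ = 6`) force exponent `3` and `#E(ℚ) ∣ 3`, and
`O, (0, 52), (0, -52)` are three distinct points.
[cite: CremonaAlgorithms1997, Table 1, N = 26, curve A1 (r = 0, |T| = 3); §3.3] -/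
theorem x_eq_zero_of_rank_zero (hr : (threeTorsionModel (7 : ℚ) 52).mordellWeilRank = 0)
    {X Y : ℚ} (hP : (threeTorsionModel (7 : ℚ) 52).toAffine.Nonsingular X Y) : X = 0 := by
  letI := Classical.decEq ℚ
  letI : DecidableEq (ZMod 3) := Classical.decEq _
  letI : DecidableEq (ZMod 11) := Classical.decEq _
  haveI : Fact (Nat.Prime 3) := ⟨by norm_num⟩
  haveI : Fact (Nat.Prime 11) := ⟨by norm_num⟩
  have hΔ0 : (threeTorsionModel (7 : ℚ) 52).Δ ≠ 0 := threeTorsionModel_seven_fiftyTwo_Δ_ne_zero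
  haveI : (threeTorsionModel (7 : ℚ) 52).IsElliptic := ⟨isUnit_iff_ne_zero.mpr hΔ0⟩
  -- rank `0` + Mordell–Weil ⟹ `E(ℚ)` finite
  haveI : Finite (threeTorsionModel (7 : ℚ) 52).toAffine.Point :=
    WeierstrassCurve.finite_point_of_rank_zero _ hr
  haveI := Fintype.ofFinite (threeTorsionModel (7 : ℚ) 52).toAffine.Point
  obtain ⟨f₃, hf₃⟩ := exists_reduceHom 3 (by norm_num [Int.isCoprime_iff_gcd_eq_one])
  obtain ⟨f₁₁, hf₁₁⟩ := exists_reduceHom 11 (by norm_num [Int.isCoprime_iff_gcd_eq_one])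
  haveI : Finite (⟨0, 49, 0, 728, 2704⟩ : WeierstrassCurve (ZMod 3)).toAffine.Point :=
    Nat.finite_of_card_ne_zero (by rw [natCard_point_reduction_three]; norm_num)
  haveI : Finite (⟨0, 49, 0, 728, 2704⟩ : WeierstrassCurve (ZMod 11)).toAffine.Point :=
    Nat.finite_of_card_ne_zero (by rw [natCard_point_reduction_eleven]; norm_num)
  -- prime-to-`3` torsion is killed by `#Ẽ(𝔽₃) = 3`, prime-to-`11` torsion by `#Ẽ(𝔽₁₁) = 6`
  have kill3 : ∀ Q ∈ goodTorsion (NormedField.valuation.comap (Rat.castHom ℚ_[3]) : Valuation ℚ ℝ≥0)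
      (threeTorsionModel (7 : ℚ) 52), 3 • Q = 0 := by
    intro Q hQ
    have key : (3 : ℕ) • (⟨Q, hQ⟩ : goodTorsion
        (NormedField.valuation.comap (Rat.castHom ℚ_[3]) : Valuation ℚ ℝ≥0)
        (threeTorsionModel (7 : ℚ) 52)) = 0 := by
      apply hf₃
      rw [map_nsmul, map_zero]
      have hc : Nat.card (⟨0, 49, 0, 728, 2704⟩ : WeierstrassCurve (ZMod 3)).toAffine.Point •
          f₃ ⟨Q, hQ⟩ = 0 := card_nsmul_eq_zero'
      rwa [natCard_point_reduction_three] at hc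
    simpa using congrArg Subtype.val key
  have kill11 : ∀ Q ∈ goodTorsion (NormedField.valuation.comap (Rat.castHom ℚ_[11]) : Valuation ℚ ℝ≥0)
      (threeTorsionModel (7 : ℚ) 52), 6 • Q = 0 := by
    intro Q hQ
    have key : (6 : ℕ) • (⟨Q, hQ⟩ : goodTorsion
        (NormedField.valuation.comap (Rat.castHom ℚ_[11]) : Valuation ℚ ℝ≥0)
        (threeTorsionModel (7 : ℚ) 52)) = 0 := by
      apply hf₁₁
      rw [map_nsmul, map_zero]
      have hc : Nat.card (⟨0, 49, 0, 728, 2704⟩ : WeierstrassCurve (ZMod 11)).toAffine.Point •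
          f₁₁ ⟨Q, hQ⟩ = 0 := card_nsmul_eq_zero'
      rwa [natCard_point_reduction_eleven] at hc
    simpa using congrArg Subtype.val key
  -- every rational point lies in the prime-to-`11` torsion
  have hgood11 : ∀ P : (threeTorsionModel (7 : ℚ) 52).toAffine.Point, P ∈ goodTorsion
      (NormedField.valuation.comap (Rat.castHom ℚ_[11]) : Valuation ℚ ℝ≥0)
      (threeTorsionModel (7 : ℚ) 52) := by
    intro P
    obtain ⟨n, hn, hnP⟩ := isOfFinAddOrder_iff_nsmul_eq_zero.mp (isOfFinAddOrder_of_finite P)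
    obtain ⟨b, m, hm, rfl⟩ := Nat.exists_eq_pow_mul_and_not_dvd hn.ne' 11 (by norm_num)
    -- `m • P` is killed by `11 ^ b`, hence lies in the prime-to-`3` torsion, hence `3 • m • P = 0`
    have hQ : m • P ∈ goodTorsion
        (NormedField.valuation.comap (Rat.castHom ℚ_[3]) : Valuation ℚ ℝ≥0)
        (threeTorsionModel (7 : ℚ) 52) := by
      refine mem_goodTorsion_of_zsmul_eq_zero (n := ((11 ^ b : ℕ) : ℤ)) ?_ ?_
      · rw [Int.cast_natCast]
        exact Curve24A1.valuation_natCast_eq_one 3 (Nat.Coprime.pow_right b (by norm_num))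
      · rw [natCast_zsmul, ← mul_nsmul', hnP]
    have h3 : 3 • m • P = 0 := kill3 _ hQ
    refine mem_goodTorsion_of_zsmul_eq_zero (n := ((3 * m : ℕ) : ℤ)) ?_ ?_
    · rw [Int.cast_natCast]
      refine Curve24A1.valuation_natCast_eq_one 11 (Nat.Coprime.mul_right (by norm_num) ?_)
      exact (Nat.Prime.coprime_iff_not_dvd (by norm_num)).mpr hm
    · rw [natCast_zsmul, mul_nsmul', h3]
  -- hence every rational point is killed by `6`, and then by `3`
  have h3P : ∀ P : (threeTorsionModel (7 : ℚ) 52).toAffine.Point, 3 • P = 0 := by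
    intro P
    have h6 : 6 • P = 0 := kill11 P (hgood11 P)
    have h2 : 2 • 3 • P = 0 := by rw [← mul_nsmul']; exact h6
    have hR : 3 • P ∈ goodTorsion
        (NormedField.valuation.comap (Rat.castHom ℚ_[3]) : Valuation ℚ ℝ≥0)
        (threeTorsionModel (7 : ℚ) 52) := by
      refine mem_goodTorsion_of_zsmul_eq_zero (n := ((2 : ℕ) : ℤ)) ?_ ?_
      · rw [Int.cast_natCast]; exact Curve24A1.valuation_natCast_eq_one 3 (by norm_num)
      · rw [natCast_zsmul]; exact h2
    have h9 : 3 • 3 • P = 0 := kill3 _ hR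
    have key : (2 + 1) • 3 • P = 2 • 3 • P + 3 • P := succ_nsmul _ _
    rw [show (2 + 1 : ℕ) = 3 from rfl, h9, h2, zero_add] at key
    exact key.symm
  -- `#E(ℚ) ∣ 6` (all of `E(ℚ)` injects into `Ẽ(𝔽₁₁)`) and `2 ∤ #E(ℚ)` (exponent `3`, Cauchy)
  have hdvd6 : Nat.card (threeTorsionModel (7 : ℚ) 52).toAffine.Point ∣ 6 := by
    have htop : goodTorsion (NormedField.valuation.comap (Rat.castHom ℚ_[11]) : Valuation ℚ ℝ≥0)
        (threeTorsionModel (7 : ℚ) 52) = ⊤ := eq_top_iff.mpr fun P _ => hgood11 P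
    have h1 := AddSubgroup.card_dvd_of_injective f₁₁ hf₁₁
    rwa [htop, AddSubgroup.card_top, natCard_point_reduction_eleven] at h1
  have h2 : ¬ 2 ∣ Nat.card (threeTorsionModel (7 : ℚ) 52).toAffine.Point := by
    intro h2
    haveI : Fact (Nat.Prime 2) := ⟨by norm_num⟩
    obtain ⟨x, hx⟩ := exists_prime_addOrderOf_dvd_card' 2 h2
    have hx3 : addOrderOf x ∣ 3 := addOrderOf_dvd_of_nsmul_eq_zero (h3P x)
    rw [hx] at hx3
    norm_num at hx3
  have hle3 : Nat.card (threeTorsionModel (7 : ℚ) 52).toAffine.Point ≤ 3 := by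
    have hcop : Nat.Coprime (Nat.card (threeTorsionModel (7 : ℚ) 52).toAffine.Point) 2 :=
      ((Nat.Prime.coprime_iff_not_dvd (by norm_num)).mpr h2).symm
    exact Nat.le_of_dvd (by norm_num) (hcop.dvd_of_dvd_mul_right (by simpa using hdvd6))
  -- the three points `O, (0, 52), (0, -52)` and the fourth `(X, Y)` if `X ≠ 0`
  by_contra hX
  have hV := isVeluThreePair_threeTorsionModel hΔ0
  have hT : (threeTorsionModel (7 : ℚ) 52).toAffine.Nonsingular 0 52 := hV.nonsingular_T
  have hT' : (threeTorsionModel (7 : ℚ) 52).toAffine.Nonsingular 0 (-52) := hV.nonsingular_negT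
  let S : Finset (threeTorsionModel (7 : ℚ) 52).toAffine.Point :=
    {Point.some X Y hP, Point.some 0 52 hT, Point.some 0 (-52) hT', 0}
  have hS : S.card = 4 := by
    simp only [S]
    rw [Finset.card_insert_of_notMem, Finset.card_insert_of_notMem, Finset.card_pair]
    · exact Affine.Point.some_ne_zero hT'
    · simp only [Finset.mem_insert, Finset.mem_singleton, Affine.Point.some.injEq, true_and,
        reduceCtorEq, or_false]
      norm_num
    · simp only [Finset.mem_insert, Finset.mem_singleton, Affine.Point.some.injEq, hX, false_and,
        reduceCtorEq, or_self, not_false_eq_true]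
  have h4 : 4 ≤ Nat.card (threeTorsionModel (7 : ℚ) 52).toAffine.Point := by
    calc 4 = S.card := hS.symm
      _ ≤ Finset.univ.card := Finset.card_le_univ S
      _ = Nat.card _ := by rw [Finset.card_univ, Nat.card_eq_fintype_card]
  omega

end KenkuLevelTwentySixMW

/-- **`hMW` of level `26` REDUCED to `rank_ℤ 26a1(ℚ) = 0`**: if
`(threeTorsionModel (7 : ℚ) 52).mordellWeilRank = 0` (the descent statement; Cremona `26a1: r = 0`),
then every rational solution of `Y² = X³ + (7X + 52)²` has `X = 0` — the displayed binder `hMW` of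
`KenkuLevelTwentySixCertificate.lean` VERBATIM (`26a1(ℚ) = {O, (0, ±52)} ≅ ℤ/3`). NOT a proof of
`hMW`: the rank statement is the input. [cite: CremonaAlgorithms1997, Table 1, N = 26, curve A1 (r = 0, |T| = 3)] -/
theorem mordellWeil_26a1_of_rank_zero (hr : (threeTorsionModel (7 : ℚ) 52).mordellWeilRank = 0) :
    ∀ X Y : ℚ, Y ^ 2 = X ^ 3 + (7 * X + 52) ^ 2 → X = 0 := by
  intro X Y h
  haveI : (threeTorsionModel (7 : ℚ) 52).IsElliptic :=
    ⟨isUnit_iff_ne_zero.mpr threeTorsionModel_seven_fiftyTwo_Δ_ne_zero⟩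
  have hE : (threeTorsionModel (7 : ℚ) 52).toAffine.Equation X Y :=
    (threeTorsionModel_seven_fiftyTwo_equation_iff X Y).mpr h
  exact KenkuLevelTwentySixMW.x_eq_zero_of_rank_zero hr
    ((Affine.equation_iff_nonsingular (W := (threeTorsionModel (7 : ℚ) 52).toAffine)).mp hE)

/-- **Level `26` of `KenkuPrintedLevels` (ii) ⟸ Klein–Fricke at `13` + `rank_ℤ 26a1(ℚ) = 0`**: with
`isCyclic_degree_ne_twentySix_of_threeTorsionModel_nonsingular` (coordinate link PROVED in
`KenkuLevelTwentySixCertificate.lean`), no elliptic curve over `ℚ` admits a cyclic `ℚ`-isogeny of degree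
`26` as soon as `threeTorsionModel 7 52` (= `26a1`) has Mordell–Weil rank `0`, granted the cite-only fact
`kleinFrickeThirteen_exists_j_eq`. [cite: Kenku1982, Thm. 1 and its proof, pp. 199–201] -/
theorem isCyclic_degree_ne_twentySix_of_rank_zero
    (h13 : kleinFrickeThirteen_exists_j_eq)
    (hr : (threeTorsionModel (7 : ℚ) 52).mordellWeilRank = 0)
    (V V' : WeierstrassCurve ℚ) [V.IsElliptic] [V'.IsElliptic] (ψ : Isogeny V V')
    (hψ : ψ.IsCyclic) : ψ.degree ≠ 26 :=
  isCyclic_degree_ne_twentySix_of_threeTorsionModel_nonsingular h13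
    (fun _ _ h ↦ KenkuLevelTwentySixMW.x_eq_zero_of_rank_zero hr h) V V' ψ hψ

end Summit.ABC.ABC.Theorems

end
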